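import Summits.FinalStateConjecture.FinalStateConjecture.Theorems.SwallowTheDatumKerrShieldedDataExistStubSliceClause
import Literature.Geometry.Lorentzian.KerrStationaryBlackHole
import Literature.Geometry.Lorentzian.KerrDataProofs
import Literature.Geometry.Lorentzian.OpensCausality
import Literature.Geometry.Lorentzian.LorentzianMetricProofs
import Literature.Topology.FourManifolds.ClosedBallProofs
import HarnessLib

/-!
# `KerrShieldedSettles`, line `tapered-temporal-collar` — stub S3 `stub_collarEmbedsMGHD`, part 1 (chart plumbing)

Support file for crux `stmt-FinalStateConjecture-10054`
(`Summit.FinalStateConjecture.FinalStateConjecture.Theses.SwallowTheDatum.KerrShieldedSettles`), stub S3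
`stub_collarEmbedsMGHD` (the tapered collar of the ingoing Kerr–Schild chart is a vacuum Cauchy development of
the pulled-back data and embeds into every maximal development).  This part supplies the chart-level objects:

* `CollarEmbedsMGHD.shiftDiffeo` — the time shift `(t, x⃗) ↦ (t + T(r x⃗), x⃗)` by the graph height
  `T = bentHeight M a` is a diffeomorphism of `Kerr.region a r₁`, whence **the bent leaf
  `graph M a r₁ = shift ∘ sliceEmbed` is a smooth embedding** (`isSmoothEmbedding_graph`, registered sub-goal
  `stub_collarEmbedsMGHDLeafEmbedding`; `Kerr.isSmoothEmbedding_sliceEmbed_holds` +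
  `Manifold.IsSmoothEmbedding.diffeomorph_comp`);
* `CollarEmbedsMGHD.collar` — the tapered collar `W = {0 < x⁰ − T(r x) + (r x − r₁)/4}` as an open subset of
  the chart, containing the leaf (`graph_mem_collar`), CONNECTED (`isConnected_collar`: image of `ℝ × slice`
  under `(σ, y) ↦ (T(r y) − (r y − r₁)/4 + e^σ, y)`), with leaf membership `x⁰ = T(r x)` (`exists_graph_eq_iff`);
* `CollarEmbedsMGHD.injective_mfderiv_of_inner_eq` — `dφ` is injective when `φ^*h = ψ^*g` and `ψ` is spacelike;
* `CollarEmbedsMGHD.isCauchyHypersurface_collar` — the chart-level Cauchy statement of stub S1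
  (`stub_collarCauchy`) is the Cauchy-hypersurface property of the leaf in the open sub-spacetime
  `(W, g|_W, τ|_W)` (`OpensCausality`: `isFutureTimelikeCurveOn_restrict_iff`, `hasFutureEndpoint_subtypeVal_comp_iff`).

References: Dafermos–Rodnianski arXiv:0811.0354 §5.1; O'Neill 1983, Ch. 14, Def. 14.28; Sbierski 2016, Def. 2.4.
-/

set_option linter.dupNamespace false

noncomputable section

open Set Filter Function
open scoped Manifold ContDiff Topology
open Literature.Geometry.Lorentzian
open Summit.FinalStateConjecture.FinalStateConjecture.Theorems.KerrShieldedDataExist.Negative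
  (bentHeight graph coe_graph radius_ofTimeSpace ofTimeSpace_mem_region)

namespace Summit.FinalStateConjecture.FinalStateConjecture.Theorems.SwallowTheDatum.KerrShieldedSettles

namespace CollarEmbedsMGHD

/-! ## The time shift by the graph height: a diffeomorphism of the chart carrying the slice to the leaf -/

section Shift

variable {M a r₁ c : ℝ}

/-- The Kerr–Schild radius of `(t, x⃗)` does not depend on `t`. [cite: arXiv07060622, (35)] -/
theorem radius_ofTimeSpace_spatial (a t : ℝ) (x : E4) :
    Kerr.radius a (E4.ofTimeSpace t (E4.spatial x)) = Kerr.radius a x := by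
  conv_rhs => rw [← E4.ofTimeSpace_time_spatial x]
  rw [radius_ofTimeSpace, radius_ofTimeSpace a (E4.time x)]

variable (M a c) in
/-- The time shift `(t, x⃗) ↦ (t + c·T(r(x⃗)), x⃗)` of `E4` by a multiple of the graph height
`T = bentHeight M a`. [folklore] -/
def shiftFun (x : E4) : E4 :=
  E4.ofTimeSpace (E4.time x + c * bentHeight M a (Kerr.radius a (E4.ofTimeSpace 0 (E4.spatial x))))
    (E4.spatial x)

/-- The time shift is `C^∞` on `E4` (the graph height is, `contDiff_bentHeight_radius`). [folklore] -/
theorem contDiff_shiftFun (hM : 0 < M) (a c : ℝ) : ContDiff ℝ ∞ (shiftFun M a c) := by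
  have h := contDiff_bentHeight_radius hM a
  have ht : ContDiff ℝ ∞ fun x : E4 ↦ E4.time x := (contDiff_euclidean.1 contDiff_id) 0
  have hs : ContDiff ℝ ∞ fun x : E4 ↦ E4.spatial x := E4.spatial.contDiff
  have heq : shiftFun M a c = fun x ↦
      (E4.time x + c * bentHeight M a (Kerr.radius a (E4.ofTimeSpace 0 (E4.spatial x)))) •
        E4.basisVector 0 + E4.spaceEmbed (E4.spatial x) :=
    funext fun x ↦ E4.ofTimeSpace_eq_smul_add' _ _
  rw [heq]
  exact ((ht.add (contDiff_const.mul (h.comp hs))).smul contDiff_const).add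
    (E4.spaceEmbed.contDiff.comp hs)

/-- The time shift preserves the Kerr–Schild radius. [folklore] -/
theorem radius_shiftFun (x : E4) : Kerr.radius a (shiftFun M a c x) = Kerr.radius a x :=
  radius_ofTimeSpace_spatial a _ x

/-- Shifting by `c` and then by `-c` is the identity. [folklore] -/
theorem shiftFun_neg_shiftFun (x : E4) : shiftFun M a (-c) (shiftFun M a c x) = x := by
  unfold shiftFun
  rw [E4.spatial_ofTimeSpace, E4.time_ofTimeSpace]
  conv_rhs => rw [← E4.ofTimeSpace_time_spatial x]
  congr 1
  ring

/-- The time shift maps the chart domain `Kerr.region a r₁` to itself. [folklore] -/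
theorem shiftFun_mem_region {x : E4} (hx : x ∈ Kerr.region a r₁) : shiftFun M a c x ∈ Kerr.region a r₁ := by
  rw [Kerr.mem_region, radius_shiftFun]; exact hx

variable (M a r₁ c) in
/-- The time shift as a self-map of the chart domain `Kerr.region a r₁`. [folklore] -/
def shift (x : Kerr.region a r₁) : Kerr.region a r₁ :=
  ⟨shiftFun M a c x, shiftFun_mem_region x.2⟩

/-- The time shift is a `C^∞` self-map of the open submanifold `Kerr.region a r₁ ⊆ E4`. [folklore] -/
theorem contMDiff_shift (hM : 0 < M) : ContMDiff 𝓘(ℝ, E4) 𝓘(ℝ, E4) ∞ (shift M a r₁ c) := by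
  intro x
  have h1 : ContMDiffAt 𝓘(ℝ, E4) 𝓘(ℝ, E4) ∞ (fun y : Kerr.region a r₁ ↦ shiftFun M a c y) x :=
    (OpensChart.contMDiffAt_iff x _ (shiftFun M a c) (fun _ ↦ rfl)).2 (contDiff_shiftFun hM a c).contDiffAt
  exact (ChartedSpace.liftPropWithinAt_subtypeVal_comp_iff (shift M a r₁ c) Set.univ x).mp h1

/-- **The time shift by the graph height is a diffeomorphism of the chart domain** (inverse: the
shift by the opposite height). [folklore] -/
def shiftDiffeo (hM : 0 < M) (a r₁ : ℝ) :
    Diffeomorph 𝓘(ℝ, E4) 𝓘(ℝ, E4) (Kerr.region a r₁) (Kerr.region a r₁) ∞ where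
  toFun := shift M a r₁ 1
  invFun := shift M a r₁ (-1)
  left_inv x := Subtype.ext (shiftFun_neg_shiftFun (x : E4))
  right_inv x := Subtype.ext (by
    have h := shiftFun_neg_shiftFun (M := M) (a := a) (c := -1) (x : E4)
    rw [neg_neg] at h
    exact h)
  contMDiff_toFun := contMDiff_shift hM
  contMDiff_invFun := contMDiff_shift hM

/-- The bent leaf is the time shift of the Kerr–Schild slice `{t* = 0}`:
`graph = shift ∘ sliceEmbed`. [folklore] -/
theorem graph_eq_shiftDiffeo_comp (hM : 0 < M) (a r₁ : ℝ) :
    graph M a r₁ = shiftDiffeo hM a r₁ ∘ Kerr.sliceEmbed a r₁ := by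
  funext y
  apply Subtype.ext
  change (graph M a r₁ y : E4) = shiftFun M a 1 (E4.ofTimeSpace 0 (y : E3))
  rw [coe_graph, shiftFun, E4.spatial_ofTimeSpace, E4.time_ofTimeSpace, zero_add, one_mul]

/-- **The bent leaf `y ↦ (T(r y), y)` is a smooth embedding of the slice into the chart** (a smooth
embedding — the slice `{t* = 0}`, `Kerr.isSmoothEmbedding_sliceEmbed_holds` — followed by a
diffeomorphism). [cite: arXiv08110354, §5.1] -/
theorem isSmoothEmbedding_graph (hM : 0 < M) (a r₁ : ℝ) :
    Manifold.IsSmoothEmbedding 𝓘(ℝ, E3) 𝓘(ℝ, E4) ∞ (graph M a r₁) := by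
  rw [graph_eq_shiftDiffeo_comp hM a r₁]
  exact (Kerr.isSmoothEmbedding_sliceEmbed_holds a r₁).diffeomorph_comp (shiftDiffeo hM a r₁)

end Shift

/-! ## The tapered collar `W = {0 < x⁰ − T(r x) + (r x − r₁)/4}` of the chart -/

section Collar

variable {M a r₁ : ℝ}

variable (M a r₁) in
/-- **The tapered temporal collar** `W = {x ∈ Kerr.region a r₁ | 0 < x⁰ − T(r x) + (r x − r₁)/4}`
(`T = bentHeight M a`): the future of the bent leaf `{x⁰ = T(r x)}` plus a past collar tapering to
zero thickness at the inner edge `r = r₁`; an open subset of the chart (continuity of `T` and `r`).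
[cite: arXiv08110354, §5.1] -/
def collar (hM : 0 < M) : TopologicalSpace.Opens (Kerr.region a r₁) :=
  ⟨{x | 0 < (x : E4) 0 - bentHeight M a (Kerr.radius a (x : E4)) + (Kerr.radius a (x : E4) - r₁) / 4}, by
    have h0 : Continuous fun x : E4 ↦ x 0 := PiLp.continuous_apply 2 _ 0
    have hc : Continuous fun x : E4 ↦
        x 0 - bentHeight M a (Kerr.radius a x) + (Kerr.radius a x - r₁) / 4 :=
      (h0.sub ((contDiff_bentHeight (n := ⊤) hM a).continuous.comp (Kerr.continuous_radius a))).add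
        (((Kerr.continuous_radius a).sub continuous_const).div_const _)
    exact isOpen_lt continuous_const (hc.comp continuous_subtype_val)⟩

/-- Membership in the collar (by `Iff.rfl`). [folklore] -/
theorem mem_collar {hM : 0 < M} {x : Kerr.region a r₁} :
    x ∈ collar M a r₁ hM ↔
      0 < (x : E4) 0 - bentHeight M a (Kerr.radius a (x : E4)) + (Kerr.radius a (x : E4) - r₁) / 4 :=
  Iff.rfl

/-- The collar function at `(t, y)`: `t − T(r(0,y)) + (r(0,y) − r₁)/4`. [folklore] -/
theorem collarFn_ofTimeSpace (t : ℝ) (y : E3) :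
    (E4.ofTimeSpace t y) 0 - bentHeight M a (Kerr.radius a (E4.ofTimeSpace t y)) +
        (Kerr.radius a (E4.ofTimeSpace t y) - r₁) / 4 =
      t - bentHeight M a (Kerr.radius a (E4.ofTimeSpace 0 y)) + (Kerr.radius a (E4.ofTimeSpace 0 y) - r₁) / 4 := by
  rw [E4.ofTimeSpace_apply_zero, radius_ofTimeSpace]

/-- The radius of the leaf point over `y` is `r(0, y)`. [folklore] -/
theorem radius_graph (y : Kerr.slice a r₁) :
    Kerr.radius a (graph M a r₁ y : E4) = Kerr.radius a (E4.ofTimeSpace 0 (y : E3)) := by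
  rw [coe_graph, radius_ofTimeSpace]

/-- The time coordinate of the leaf point over `y` is `T(r(0, y))`. [folklore] -/
theorem graph_apply_zero (y : Kerr.slice a r₁) :
    (graph M a r₁ y : E4) 0 = bentHeight M a (Kerr.radius a (E4.ofTimeSpace 0 (y : E3))) := by
  rw [coe_graph, E4.ofTimeSpace_apply_zero]

/-- Slice points have `r > r₁`. [folklore] -/
theorem lt_radius_slice (y : Kerr.slice a r₁) : r₁ < Kerr.radius a (E4.ofTimeSpace 0 (y : E3)) :=
  (le_max_left _ _).trans_lt (Kerr.mem_slice.1 y.2)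

/-- **The bent leaf lies in the collar** (`u = 0`, `r > r₁`). [folklore] -/
theorem graph_mem_collar (hM : 0 < M) (y : Kerr.slice a r₁) : graph M a r₁ y ∈ collar M a r₁ hM := by
  rw [mem_collar, radius_graph, graph_apply_zero, sub_self, zero_add]
  have := lt_radius_slice y
  linarith

/-- The spatial part of a chart point lies in the slice (the radius is time-independent). [folklore] -/
theorem spatial_mem_slice (x : Kerr.region a r₁) : E4.spatial (x : E4) ∈ Kerr.slice a r₁ := by
  rw [Kerr.mem_slice, radius_ofTimeSpace_spatial]; exact x.2

/-- **A chart point lies on the bent leaf iff `x⁰ = T(r x)`.** [folklore] -/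
theorem exists_graph_eq_iff {x : Kerr.region a r₁} :
    (∃ y, graph M a r₁ y = x) ↔ (x : E4) 0 = bentHeight M a (Kerr.radius a (x : E4)) := by
  constructor
  · rintro ⟨y, rfl⟩
    rw [graph_apply_zero, radius_graph]
  · intro hx
    refine ⟨⟨E4.spatial (x : E4), spatial_mem_slice x⟩, Subtype.ext ?_⟩
    change E4.ofTimeSpace (bentHeight M a (Kerr.radius a (E4.ofTimeSpace 0 (E4.spatial (x : E4)))))
      (E4.spatial (x : E4)) = (x : E4)
    rw [radius_ofTimeSpace_spatial, ← hx]
    exact E4.ofTimeSpace_time_spatial (x : E4)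

variable (M a r₁) in
/-- The parametrisation `(σ, y) ↦ (T(r y) − (r y − r₁)/4 + e^σ, y)` of the collar by `ℝ × slice`.
[folklore] -/
def collarParam (p : ℝ × Kerr.slice a r₁) : Kerr.region a r₁ :=
  ⟨E4.ofTimeSpace (bentHeight M a (Kerr.radius a (E4.ofTimeSpace 0 (p.2 : E3))) -
      (Kerr.radius a (E4.ofTimeSpace 0 (p.2 : E3)) - r₁) / 4 + Real.exp p.1) (p.2 : E3),
    ofTimeSpace_mem_region _ p.2.2⟩

/-- Unfolding lemma for `collarParam`. [folklore] -/
theorem coe_collarParam (p : ℝ × Kerr.slice a r₁) :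
    (collarParam M a r₁ p : E4) =
      E4.ofTimeSpace (bentHeight M a (Kerr.radius a (E4.ofTimeSpace 0 (p.2 : E3))) -
        (Kerr.radius a (E4.ofTimeSpace 0 (p.2 : E3)) - r₁) / 4 + Real.exp p.1) (p.2 : E3) :=
  rfl

/-- The parametrisation of the collar is continuous. [folklore] -/
theorem continuous_collarParam (hM : 0 < M) : Continuous (collarParam M a r₁) := by
  refine Continuous.subtype_mk ?_ _
  have hof : Continuous fun q : ℝ × E3 ↦ E4.ofTimeSpace q.1 q.2 := by
    have : (fun q : ℝ × E3 ↦ E4.ofTimeSpace q.1 q.2) = fun q ↦ q.1 • E4.basisVector 0 + E4.spaceEmbed q.2 :=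
      funext fun q ↦ E4.ofTimeSpace_eq_smul_add' _ _
    rw [this]
    exact (continuous_fst.smul continuous_const).add (E4.spaceEmbed.continuous.comp continuous_snd)
  have hr : Continuous fun p : ℝ × Kerr.slice a r₁ ↦ Kerr.radius a (E4.ofTimeSpace 0 (p.2 : E3)) :=
    (Kerr.continuous_radius a).comp
      ((E4.continuous_ofTimeSpace 0).comp (continuous_subtype_val.comp continuous_snd))
  have hT : Continuous fun p : ℝ × Kerr.slice a r₁ ↦
      bentHeight M a (Kerr.radius a (E4.ofTimeSpace 0 (p.2 : E3))) :=
    (contDiff_bentHeight (n := ⊤) hM a).continuous.comp hr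
  exact hof.comp (((hT.sub ((hr.sub continuous_const).div_const _)).add
    (Real.continuous_exp.comp continuous_fst)).prodMk (continuous_subtype_val.comp continuous_snd))

/-- The collar is the range of its parametrisation. [folklore] -/
theorem range_collarParam (hM : 0 < M) :
    range (collarParam M a r₁) = (collar M a r₁ hM : Set (Kerr.region a r₁)) := by
  ext x
  constructor
  · rintro ⟨p, rfl⟩
    rw [SetLike.mem_coe, mem_collar, coe_collarParam, collarFn_ofTimeSpace]
    have := Real.exp_pos p.1
    linarith
  · intro hx
    rw [SetLike.mem_coe, mem_collar] at hx
    refine ⟨(Real.log ((x : E4) 0 - bentHeight M a (Kerr.radius a (x : E4)) +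
      (Kerr.radius a (x : E4) - r₁) / 4), ⟨E4.spatial (x : E4), spatial_mem_slice x⟩), Subtype.ext ?_⟩
    rw [coe_collarParam]
    change E4.ofTimeSpace (bentHeight M a (Kerr.radius a (E4.ofTimeSpace 0 (E4.spatial (x : E4)))) -
        (Kerr.radius a (E4.ofTimeSpace 0 (E4.spatial (x : E4))) - r₁) / 4 +
          Real.exp (Real.log ((x : E4) 0 - bentHeight M a (Kerr.radius a (x : E4)) +
            (Kerr.radius a (x : E4) - r₁) / 4))) (E4.spatial (x : E4)) = (x : E4)
    rw [radius_ofTimeSpace_spatial, Real.exp_log hx]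
    conv_rhs => rw [← E4.ofTimeSpace_time_spatial (x : E4)]
    congr 1
    rw [E4.time_apply]
    ring

/-- **The collar is connected**: it is the continuous image of the connected space `ℝ × slice`
(`Kerr.isConnected_slice_holds`). [cite: ONeill1995, Ch. 2 §2.1] -/
theorem isConnected_collar (hM : 0 < M) : IsConnected (collar M a r₁ hM : Set (Kerr.region a r₁)) := by
  haveI : ConnectedSpace (Kerr.slice a r₁) :=
    isConnected_iff_connectedSpace.mp (Kerr.isConnected_slice_holds a r₁)
  rw [← range_collarParam hM]
  exact isConnected_range (continuous_collarParam hM)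

end Collar

/-! ## Injectivity of `dφ`; the leaf is a Cauchy hypersurface of the collar sub-spacetime -/

section Cauchy

variable {M a r₁ : ℝ}

/-- **Injectivity of `dφ`** from the shield's pull-back identity `φ^*h = ψ^*g` (pointwise) and
spacelikeness of `ψ`: `h(dφ v, dφ v) = g(dψ v, dψ v) > 0` for `v ≠ 0`. [folklore] -/
theorem injective_mfderiv_of_inner_eq [Kerr.Facts] {X : Type*} [TopologicalSpace X] [ChartedSpace E3 X]
    [IsManifold (𝓡 3) ∞ X] (D : InitialDataSet (𝓡 3) X)
    {φ : Kerr.slice a r₁ → X} {ψ : Kerr.slice a r₁ → Kerr.region a r₁}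
    (hsp : (Kerr.smoothMetric M a r₁).IsSpacelikeImmersion 𝓘(ℝ, E3) ψ)
    (hh : ∀ (y : Kerr.slice a r₁) (v w : E3),
        D.h.inner (φ y) (mfderiv 𝓘(ℝ, E3) (𝓡 3) φ y v) (mfderiv 𝓘(ℝ, E3) (𝓡 3) φ y w) =
          Kerr.bilin M a (ψ y : E4) (mfderiv 𝓘(ℝ, E3) 𝓘(ℝ, E4) ψ y v)
            (mfderiv 𝓘(ℝ, E3) 𝓘(ℝ, E4) ψ y w))
    (u : Kerr.slice a r₁) : Injective (mfderiv (𝓡 3) (𝓡 3) φ u) := by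
  refine (injective_iff_map_eq_zero _).mpr fun v hv ↦ ?_
  by_contra hne
  have hpos := hsp.inducedBilin_pos u hne
  rw [PseudoRiemannianMetric.inducedBilin_apply] at hpos
  -- the pull-back identity on `(v, v)` (`Kerr.smoothMetric_val` holds by `rfl`)
  have key : D.h.inner (φ u) (mfderiv 𝓘(ℝ, E3) (𝓡 3) φ u v) (mfderiv 𝓘(ℝ, E3) (𝓡 3) φ u v) =
      (Kerr.smoothMetric M a r₁).val (ψ u) (mfderiv 𝓘(ℝ, E3) 𝓘(ℝ, E4) ψ u v)
        (mfderiv 𝓘(ℝ, E3) 𝓘(ℝ, E4) ψ u v) := hh u v v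
  have hv' : mfderiv 𝓘(ℝ, E3) (𝓡 3) φ u v = 0 := hv
  rw [hv', map_zero] at key
  exact (ne_of_lt hpos) key

/-- **The bent leaf is a Cauchy hypersurface of the collar sub-spacetime `(W, g|_W, τ|_W)`**, given the
chart-level statement (stub S1 `stub_collarCauchy`: every future-timelike chart curve in `W` without
endpoint in `W` meets `{x⁰ = T(r x)}` exactly once): an endless timelike curve `γ` of the open
sub-spacetime `W` is a future-timelike chart curve after composing with the inclusion
(`isFutureTimelikeCurveOn_restrict_iff`), lies in `W`, and has no endpoint in `W`
(`hasFutureEndpoint_subtypeVal_comp_iff`); leaf membership is `x⁰ = T(r x)` (`exists_graph_eq_iff`).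
[cite: ONeillSemiRiemannian1983, Ch. 14, Def. 14.28 (p. 415)] -/
theorem isCauchyHypersurface_collar [Kerr.Facts] (hM : 0 ≤ M) (hM0 : 0 < M)
    (hC : ∀ (γ : ℝ → Kerr.region a r₁) (s : Set ℝ), s.OrdConnected → s.Nonempty →
      (Kerr.smoothMetric M a r₁).IsFutureTimelikeCurveOn
          ((Kerr.timeOrientation M a r₁ hM).ofLE le_top) γ s →
      (∀ t ∈ s, 0 < (γ t : E4) 0 - bentHeight M a (Kerr.radius a (γ t : E4)) +
          (Kerr.radius a (γ t : E4) - r₁) / 4) →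
      (∀ q : Kerr.region a r₁, 0 < (q : E4) 0 - bentHeight M a (Kerr.radius a (q : E4)) +
          (Kerr.radius a (q : E4) - r₁) / 4 →
            ¬ HasFutureEndpoint γ s q ∧ ¬ HasPastEndpoint γ s q) →
      ∃! t, t ∈ s ∧ (γ t : E4) 0 = bentHeight M a (Kerr.radius a (γ t : E4))) :
    ((Kerr.smoothMetric M a r₁).restrict PseudoRiemannianMetric.contMDiff_restrict_holds
        (collar M a r₁ hM0)).IsCauchyHypersurface
      (((Kerr.timeOrientation M a r₁ hM).ofLE le_top).restrict PseudoRiemannianMetric.contMDiff_restrict_holds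
        (TimeOrientation.contMDiff_restrict_holds _) (collar M a r₁ hM0))
      (range fun y : Kerr.slice a r₁ ↦ (⟨graph M a r₁ y, graph_mem_collar hM0 y⟩ : collar M a r₁ hM0)) := by
  intro γ s hγ
  obtain ⟨hs, htl, hfe, hpe⟩ := hγ
  have htl' := (LorentzianMetric.isFutureTimelikeCurveOn_restrict_iff _ _ _ _ _).1 htl
  have hW : ∀ t ∈ s, 0 < ((Subtype.val ∘ γ) t : E4) 0 -
      bentHeight M a (Kerr.radius a ((Subtype.val ∘ γ) t : E4)) +
        (Kerr.radius a ((Subtype.val ∘ γ) t : E4) - r₁) / 4 := fun t _ ↦ (γ t).2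
  have hend : ∀ q : Kerr.region a r₁, 0 < (q : E4) 0 - bentHeight M a (Kerr.radius a (q : E4)) +
      (Kerr.radius a (q : E4) - r₁) / 4 →
        ¬ HasFutureEndpoint (Subtype.val ∘ γ) s q ∧ ¬ HasPastEndpoint (Subtype.val ∘ γ) s q :=
    fun q hq ↦ ⟨fun h ↦ hfe.2 ⟨q, hq⟩ (hasFutureEndpoint_subtypeVal_comp_iff.1 h),
      fun h ↦ hpe.2 ⟨q, hq⟩ (hasPastEndpoint_subtypeVal_comp_iff.1 h)⟩
  obtain ⟨t, ⟨hts, ht⟩, huniq⟩ := hC (Subtype.val ∘ γ) s hs hfe.1 htl' hW hend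
  refine ⟨t, ⟨hts, ?_⟩, fun t' ht' ↦ huniq t' ⟨ht'.1, ?_⟩⟩
  · obtain ⟨y, hy⟩ := (exists_graph_eq_iff (x := (γ t : Kerr.region a r₁))).2 ht
    exact ⟨y, Subtype.ext hy⟩
  · obtain ⟨y, hy⟩ := ht'.2
    exact (exists_graph_eq_iff (x := (γ t' : Kerr.region a r₁))).1 ⟨y, congrArg Subtype.val hy⟩

end Cauchy

end CollarEmbedsMGHD

/-- **Registered sub-goal `stub_collarEmbedsMGHDLeafEmbedding` — the bent leaf is a smooth embedding.**  For
`0 < M` (any `a`, any inner radius `r₁`) the graph `y ↦ (T(r(0, y)), y)` of the hard-coded height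
`T = bentHeight M a` is a smooth embedding of the Kerr–Schild slice `Kerr.slice a r₁` into the chart domain
`Kerr.region a r₁` (Mathlib's `Manifold.IsSmoothEmbedding`: immersion + homeomorphism onto the image): it is
the slice embedding `{t* = 0}` followed by the time-shift diffeomorphism `CollarEmbedsMGHD.shiftDiffeo`.  This is
the `isSmoothEmbedding` field of the data embedding of the shield in `stub_collarEmbedsMGHD`.
Dafermos–Rodnianski arXiv:0811.0354, §5.1; Lee 2013, Ch. 4–5. [cite: arXiv08110354, §5.1] -/
theorem stub_collarEmbedsMGHDLeafEmbedding : ∀ (M a r₁ : ℝ), 0 < M →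
    Manifold.IsSmoothEmbedding 𝓘(ℝ, E3) 𝓘(ℝ, E4) ((⊤ : ℕ∞) : WithTop ℕ∞)
      (Summit.FinalStateConjecture.FinalStateConjecture.Theorems.KerrShieldedDataExist.Negative.graph M a r₁) :=
  fun _ a r₁ hM ↦ CollarEmbedsMGHD.isSmoothEmbedding_graph hM a r₁

end Summit.FinalStateConjecture.FinalStateConjecture.Theorems.SwallowTheDatum.KerrShieldedSettles

end
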